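import Mathlib
import Summits.KontsevichZagierPeriods.KontsevichZagierPeriods.Theorems.SoloInformedNashChain
import HarnessLib
/-!
# SoloInformed — cores of charts and the chart form `ψ^*ω = G dw`

File I2c₂a of the (HT) step (`SoloInformedNashHT`) of the solo-informed programme (support for the
Coons cell `soloInformed_kappaPath_coons` and for the chords of the Stokes grid).

* the *core* of a holomorphic chart `c` of the curve (`SoloInformedChart`): the points of
  `Z(ℂ) ∩ Ω` whose chart coordinate lies in `ball w₀ (ε/4)`; on the core `ψ(z_{i₀}) = z`;
* the chart form `G(w) = Σⱼ ωⱼ(ψ(w)) ψⱼ′(w)` (so `ψ^*(Σⱼ ωⱼ dzⱼ) = G dw`), holomorphic on the disc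
  (polynomials of holomorphic functions, `soloInformed_analyticOnNhd_eval`).

References: Huber–Wüstholz, *Transcendence and linear relations of 1-periods* (2022), §3.3.1, §7.2.
-/

noncomputable section

open scoped BigOperators Topology
open Set Metric MvPolynomial
open Literature.NumberTheory.Transcendental Literature.NumberTheory.Transcendental.KZ
open Literature.NumberTheory.Transcendental.CurvePeriods
open Literature.ModelTheory.ExponentialFields

namespace Summit.KontsevichZagierPeriods.KontsevichZagierPeriods.Theorems

/-! ## 3. Cores of charts and the chart form `G dw = ψ^* ω` -/

variable {Z : CurveData}

/-- The *core* of a chart: points of `Z(ℂ) ∩ Ω` whose chart coordinate lies in the disc of a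
quarter of the radius (so that Coons patches of curves in the core stay in the chart). -/
def soloInformedCore (c : SoloInformedChart Z) : Set (Fin Z.n → ℂ) :=
  {z | z ∈ Z.points ∧ z ∈ c.Ω ∧ z c.i₀ ∈ ball c.w₀ (c.ε / 4)}

namespace SoloInformedChart

variable (c : SoloInformedChart Z)

/-- A core point is `ψ` of its coordinate. -/
theorem psi_coord_of_mem_core {z : Fin Z.n → ℂ} (hz : z ∈ soloInformedCore c) :
    c.ψ (z c.i₀) = z :=
  c.apply_coord hz.2.1 hz.1

/-- The coordinate of a core point is within `ε/4` of the centre. -/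
theorem norm_coord_sub_le_of_mem_core {z : Fin Z.n → ℂ} (hz : z ∈ soloInformedCore c) :
    ‖z c.i₀ - c.w₀‖ ≤ c.ε / 4 :=
  (mem_ball_iff_norm.1 hz.2.2).le

/-- The coordinate of a core point lies in the disc. -/
theorem coord_mem_ball_of_mem_core {z : Fin Z.n → ℂ} (hz : z ∈ soloInformedCore c) :
    z c.i₀ ∈ ball c.w₀ c.ε := by
  have h := hz.2.2
  have hε : 0 < c.ε := by
    have := Metric.nonempty_ball.1 ⟨_, h⟩
    linarith
  exact Metric.ball_subset_ball (by linarith) h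

/-- A chart with a core point has positive radius. -/
theorem eps_pos_of_mem_core {z : Fin Z.n → ℂ} (hz : z ∈ soloInformedCore c) : 0 < c.ε := by
  have := Metric.nonempty_ball.1 ⟨_, hz.2.2⟩
  linarith

/-- The coordinates of the chart map are holomorphic on the disc. -/
theorem analyticOnNhd_coord (j : Fin Z.n) :
    AnalyticOnNhd ℂ (fun w => c.ψ w j) (ball c.w₀ c.ε) :=
  (ContinuousLinearMap.proj (R := ℂ) (φ := fun _ : Fin Z.n => ℂ) j).comp_analyticOnNhd c.analytic

/-- The derivative of a chart coordinate at a point of the disc. -/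
theorem hasDerivAt_coord {w : ℂ} (hw : w ∈ ball c.w₀ c.ε) (j : Fin Z.n) :
    HasDerivAt (fun w => c.ψ w j) (deriv (fun w => c.ψ w j) w) w :=
  ((c.analyticOnNhd_coord j) w hw).differentiableAt.hasDerivAt

end SoloInformedChart

/-- **The chart form** `G = Σⱼ ωⱼ(ψ(w)) ψⱼ′(w)`, so that `ψ^* (Σⱼ ωⱼ dzⱼ) = G(w) dw`. -/
def soloInformedChartForm (c : SoloInformedChart Z) (ω : Fin Z.n → MvPolynomial (Fin Z.n) ℂ)
    (w : ℂ) : ℂ :=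
  ∑ j, eval (c.ψ w) (ω j) * deriv (fun w => c.ψ w j) w

/-- Polynomials in holomorphic coordinate functions are holomorphic. -/
theorem soloInformed_analyticOnNhd_eval {n : ℕ} {f : ℂ → Fin n → ℂ} {s : Set ℂ}
    (hf : ∀ i, AnalyticOnNhd ℂ (fun w => f w i) s) (p : MvPolynomial (Fin n) ℂ) :
    AnalyticOnNhd ℂ (fun w => eval (f w) p) s := by
  induction p using MvPolynomial.induction_on with
  | C a => simpa only [eval_C] using (analyticOnNhd_const : AnalyticOnNhd ℂ (fun _ : ℂ => a) s)
  | add p q hp hq => simpa only [map_add, Pi.add_def] using hp.add hq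
  | mul_X p i hp => simpa only [map_mul, eval_X] using hp.mul (hf i)

/-- The chart form is holomorphic on the disc. -/
theorem soloInformed_analyticOnNhd_chartForm (c : SoloInformedChart Z)
    (ω : Fin Z.n → MvPolynomial (Fin Z.n) ℂ) :
    AnalyticOnNhd ℂ (soloInformedChartForm c ω) (ball c.w₀ c.ε) := by
  have h : soloInformedChartForm c ω = ∑ j ∈ (Finset.univ : Finset (Fin Z.n)),
      (fun w => eval (c.ψ w) (ω j) * deriv (fun w => c.ψ w j) w) := by
    funext w
    simp only [soloInformedChartForm, Finset.sum_apply]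
  rw [h]
  refine Finset.analyticOnNhd_sum _ fun j _ => ?_
  exact (soloInformed_analyticOnNhd_eval (fun i => c.analyticOnNhd_coord i) (ω j)).mul
    (c.analyticOnNhd_coord j).deriv

end Summit.KontsevichZagierPeriods.KontsevichZagierPeriods.Theorems
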